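import Literature.NumberTheory.Automorphic.CuspidalGL2LocalEulerFactor
import Literature.NumberTheory.Automorphic.GL2RSLFactorUnramifiedComputation
import Literature.NumberTheory.Automorphic.LocalComponentBJSatakeProofs
import HarnessLib

/-!
# The local Euler factor of a cuspidal `π` on `GL₂(𝔸_F)` at an unramified place is
# `∏ᵢ (1 - aᵢ q^{-s})⁻¹` over the Satake parameter (Jacquet–Langlands 1970, Prop. 3.5; Flath)

Topic `Literature/NumberTheory/Automorphic`; proof file (theorems only: no definition, no named
fact, no instance).  Clause **(U)** of the standard `L`-function theory of cuspidal `GL(2)`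
(`JacquetLanglands1970_standardLTheoryGL2`) in the language of the canonical local Euler
polynomial of `CuspidalGL2LocalEulerFactor`: if the cuspidal `π` has Satake parameter `A` at the
finite place `u` (`HasSatakeParamAt`, hence is unramified there), then

* `hasRSLFactor_localComponent_satakePairPolynomial_of_hasSatakeParamAt` — EVERY irreducible
  smooth local component `π_u`, for every non-trivial continuous `ψ`, all Borel structures and
  every invariant Radon full-support `ν`, has JPSS `L`-polynomial
  `satakePairPolynomial A {1} = ∏_{a ∈ A} (1 - a X)` (`L(s, π_u) = ∏ (1 - a q^{-s})⁻¹`);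
* `localEulerPolynomial_eq_satakePairPolynomial_of_hasSatakeParamAt` — consequently THE local
  Euler polynomial of `π` at `u` (the unique `P` of `existsUnique_localEulerPolynomial`) is
  `satakePairPolynomial A {1}`.

Proof: the local component is spherical with local Satake parameter `A`
(`CuspidalAutomorphicRepData.isSatakeParameter_of_hasLocalComponentAt`, Flath + Borel–Jacquet, in
`LocalComponentBJSatakeProofs`), generic for Tate's character
(`isGeneric_of_hasLocalComponentAt`), so the unramified computation
`hasRSLFactor_satakePairPolynomial_smoothIrrep` (`GL2RSLFactorUnramifiedComputation`) applies for
Tate's character and one measure; the universal property of the local Euler polynomial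
(`exists_localEulerPolynomial`, uniqueness `existsUnique_hasRSLFactor_smoothIrrep_fin_two`)
transports it to all data.

## References

* H. Jacquet, R. P. Langlands, *Automorphic Forms on GL(2)*, LNM 114 (1970), Prop. 3.5,
  Thm. 11.1. [JacquetLanglands1970]
* D. Flath, *Decomposition of representations into tensor products*, Corvallis 1979, Thm. 3.
  [FlathCorvallis1979]
* H. Jacquet, J. A. Shalika, Amer. J. Math. 103 (1981), §2. [JacquetShalika1981]
-/

noncomputable section

open scoped MatrixGroups NNReal Classical
open MeasureTheory NumberField IsDedekindDomain Polynomial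

namespace Literature.NumberTheory.Automorphic

variable {F : Type} [Field F] [NumberField F] {hcpt : isCompact_glFiniteIntegralLevel 2 F}

open Valuation in
/-- **Clause (U) over local components** (Jacquet–Langlands 1970, Prop. 3.5; Flath 1979, Thm. 3):
if `π` has Satake parameter `A` at `u`, every irreducible smooth local component of `π` at `u` has
JPSS `L`-polynomial `∏_{a ∈ A} (1 - aX)` for every `ψ`, all Borel structures and every `ν`.
[cite: JacquetLanglands1970, Prop. 3.5] [cite: FlathCorvallis1979, Thm. 3] -/
theorem hasRSLFactor_localComponent_satakePairPolynomial_of_hasSatakeParamAt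
    (π : CuspidalAutomorphicRepData 2 F hcpt) (u : HeightOneSpectrum (𝓞 F)) {A : Multiset ℂ}
    (hA : π.1.HasSatakeParamAt u A)
    (πu : SmoothIrrep (GL (Fin 2) (u.adicCompletion F))) (hloc : π.1.HasLocalComponentAt u πu.ρ)
    {ψ : AddChar (u.adicCompletion F) Circle} (hψ : ψ.IsContinuousNontrivial)
    [MeasurableSpace (u.adicCompletion F)] [BorelSpace (u.adicCompletion F)]
    [MeasurableSpace (GL (Fin 1) (u.adicCompletion F) ⧸ upperUnitriangular (Fin 1) (u.adicCompletion F))]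
    [BorelSpace (GL (Fin 1) (u.adicCompletion F) ⧸ upperUnitriangular (Fin 1) (u.adicCompletion F))]
    (ν : Measure (GL (Fin 1) (u.adicCompletion F) ⧸ upperUnitriangular (Fin 1) (u.adicCompletion F)))
    [SMulInvariantMeasure (GL (Fin 1) (u.adicCompletion F))
      (GL (Fin 1) (u.adicCompletion F) ⧸ upperUnitriangular (Fin 1) (u.adicCompletion F)) ν]
    [IsFiniteMeasureOnCompacts ν] [ν.IsOpenPosMeasure] :
    HasRSLFactor Nat.one_lt_two πu.ρ (Representation.trivial ℂ (GL (Fin 1) (u.adicCompletion F)) ℂ)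
      ψ ν (satakePairPolynomial A {1}) := by
  haveI := πu.isIrreducible
  -- the canonical local Euler polynomial `P` (valid for all data) …
  obtain ⟨P, -, -, hP⟩ := exists_localEulerPolynomial π u
  -- … equals `∏ (1 - aX)`: compare at Tate's character and one measure
  have hψ₀ : ((adeleAddChar F).adicComponent u).IsContinuousNontrivial :=
    (isGlobalAddChar_adeleAddChar F).isContinuousNontrivial_adicComponent
      (adicComponent_adeleAddChar_ne_one u)
  have hgen₀ : IsGeneric πu.ρ ((adeleAddChar F).adicComponent u) :=
    π.isGeneric_of_hasLocalComponentAt u πu.ρ πu.isSmooth hloc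
  obtain ⟨ϖ, hϖ⟩ := exists_isUniformizer_of_isCyclic_of_nontrivial
    (ValuativeRel.valuation (u.adicCompletion F))
  have hα : IsSatakeParameter πu.ρ (Units.mk0 (ϖ : u.adicCompletion F) hϖ.ne_zero) A :=
    π.isSatakeParameter_of_hasLocalComponentAt u πu.ρ πu.isSmooth hloc hA
      (ϖ' := Units.mk0 (ϖ : u.adicCompletion F) hϖ.ne_zero) (by exact hϖ)
  have hU := hasRSLFactor_satakePairPolynomial_smoothIrrep πu hψ₀ hgen₀
    (ϖ := Units.mk0 (ϖ : u.adicCompletion F) hϖ.ne_zero) (by exact hϖ) hα ν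
  obtain ⟨P₀, -, huniq⟩ := existsUnique_hasRSLFactor_smoothIrrep_fin_two πu hψ₀ hgen₀ ν
  have hPeq : P = satakePairPolynomial A {1} := by
    rw [huniq P (hP πu hloc _ hψ₀ ν), huniq _ hU]
  rw [← hPeq]
  exact hP πu hloc ψ hψ ν

/-- **Clause (U) for the canonical local Euler polynomial** (Jacquet–Langlands 1970, Prop. 3.5):
if `π` has Satake parameter `A` at `u`, then the local Euler polynomial of `π` at `u` — any `P`
with the universal property of `exists_localEulerPolynomial` / `existsUnique_localEulerPolynomial`
— is `∏_{a ∈ A} (1 - aX)`, i.e. `L(s, π_u) = ∏_{a ∈ A} (1 - a q_u^{-s})⁻¹`.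
[cite: JacquetLanglands1970, Prop. 3.5] [cite: FlathCorvallis1979, Thm. 3] -/
theorem localEulerPolynomial_eq_satakePairPolynomial_of_hasSatakeParamAt
    (π : CuspidalAutomorphicRepData 2 F hcpt) (u : HeightOneSpectrum (𝓞 F)) {A : Multiset ℂ}
    (hA : π.1.HasSatakeParamAt u A) {P : ℂ[X]}
    (hP : ∀ (πu : SmoothIrrep (GL (Fin 2) (u.adicCompletion F))), π.1.HasLocalComponentAt u πu.ρ →
      ∀ (ψ : AddChar (u.adicCompletion F) Circle), ψ.IsContinuousNontrivial →
      ∀ [MeasurableSpace (u.adicCompletion F)] [BorelSpace (u.adicCompletion F)]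
        [MeasurableSpace (GL (Fin 1) (u.adicCompletion F) ⧸ upperUnitriangular (Fin 1) (u.adicCompletion F))]
        [BorelSpace (GL (Fin 1) (u.adicCompletion F) ⧸ upperUnitriangular (Fin 1) (u.adicCompletion F))]
        (ν : Measure (GL (Fin 1) (u.adicCompletion F) ⧸ upperUnitriangular (Fin 1) (u.adicCompletion F)))
        [SMulInvariantMeasure (GL (Fin 1) (u.adicCompletion F))
          (GL (Fin 1) (u.adicCompletion F) ⧸ upperUnitriangular (Fin 1) (u.adicCompletion F)) ν]
        [IsFiniteMeasureOnCompacts ν] [ν.IsOpenPosMeasure],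
        HasRSLFactor Nat.one_lt_two πu.ρ
          (Representation.trivial ℂ (GL (Fin 1) (u.adicCompletion F)) ℂ) ψ ν P) :
    P = satakePairPolynomial A {1} := by
  obtain ⟨P₁, -, huniq⟩ := existsUnique_localEulerPolynomial π u
  rw [huniq P hP, huniq (satakePairPolynomial A {1}) fun πu hloc ψ hψ _ _ _ _ ν _ _ _ =>
    hasRSLFactor_localComponent_satakePairPolynomial_of_hasSatakeParamAt π u hA πu hloc hψ ν]

/-- **The local Euler polynomial at an unramified place is `∏ (1 - aX)` for SOME Satake
parameter** (existential form of clause (U)). [cite: JacquetLanglands1970, Prop. 3.5] -/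
theorem exists_localEulerPolynomial_eq_satakePairPolynomial_of_isUnramifiedAt
    (π : CuspidalAutomorphicRepData 2 F hcpt) (u : HeightOneSpectrum (𝓞 F))
    (hπ : π.1.IsUnramifiedAt u) :
    ∃ A : Multiset ℂ, π.1.HasSatakeParamAt u A ∧
      ∀ (πu : SmoothIrrep (GL (Fin 2) (u.adicCompletion F))), π.1.HasLocalComponentAt u πu.ρ →
      ∀ (ψ : AddChar (u.adicCompletion F) Circle), ψ.IsContinuousNontrivial →
      ∀ [MeasurableSpace (u.adicCompletion F)] [BorelSpace (u.adicCompletion F)]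
        [MeasurableSpace (GL (Fin 1) (u.adicCompletion F) ⧸ upperUnitriangular (Fin 1) (u.adicCompletion F))]
        [BorelSpace (GL (Fin 1) (u.adicCompletion F) ⧸ upperUnitriangular (Fin 1) (u.adicCompletion F))]
        (ν : Measure (GL (Fin 1) (u.adicCompletion F) ⧸ upperUnitriangular (Fin 1) (u.adicCompletion F)))
        [SMulInvariantMeasure (GL (Fin 1) (u.adicCompletion F))
          (GL (Fin 1) (u.adicCompletion F) ⧸ upperUnitriangular (Fin 1) (u.adicCompletion F)) ν]
        [IsFiniteMeasureOnCompacts ν] [ν.IsOpenPosMeasure],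
        HasRSLFactor Nat.one_lt_two πu.ρ
          (Representation.trivial ℂ (GL (Fin 1) (u.adicCompletion F)) ℂ) ψ ν
          (satakePairPolynomial A {1}) := by
  obtain ⟨A, hA⟩ := hπ
  exact ⟨A, hA, fun πu hloc ψ hψ _ _ _ _ ν _ _ _ =>
    hasRSLFactor_localComponent_satakePairPolynomial_of_hasSatakeParamAt π u hA πu hloc hψ ν⟩

end Literature.NumberTheory.Automorphic

end
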